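import Summits.AtomisticToContinuum.Crystallization.Theorems.ChartedZeroExcessLayeredLatticeLiouvilleTG
import Summits.AtomisticToContinuum.Crystallization.Theorems.ChartedZeroExcessLayeredLatticeLiouvilleTF
import Summits.AtomisticToContinuum.Crystallization.Theorems.ChartedPlanarOrderBarlowGluing

/-!
# Zero-excess layered lattice Liouville — part TH (lens-2 g35, node «TransplantAndPin» beneath (A0♭⁺) of part TG): the existence half
(A0♭⁺) `EquilChartBondIsoP` is CUT into three pieces over EXPLICIT data, all pinned to the lattice `L` of the scale-`R` hypothesis chart so that they
compose — (B1) `WordTransplantP` (EXISTENCE, the one residual of existence type: the lattice `L` of any scale-`R` registration carries an equilibrium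
chart Barlow-charted by `S`'s OWN Hägg word; no map, no level), (B2) `BondIsoPinningP` (PINNING ESTIMATE: a bijective bond isomorphism onto an
equilibrium chart on `L` can be re-anchored — chart translated, correspondence composed with a contact-graph automorphism — so that it registers
`win R` at level `C♭·η`; no existence content), (B4) `BondIsoTearFreeP` (GEOMETRY: a bijective bond isomorphism between clean configurations is two-sided
tear-free `4 ↦ 8`) — glue PROVED (`equilChartBondIsoP_of_pieces`), the DICTIONARY between the chart currency (`IsCharted`: a Hägg word and a Barlow
chart) and the bond-isomorphism currency (`IsBondIso`) PROVED both ways (D1 `exists_bijOn_bondIso_of_barlowCharts`, D2 `IsBarlowChart.transport`,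
`isCharted_of_bijOn_bondIso`), MODEL CHARTING PROVED from lens-3's `barlowGluingW_holds` (`isCharted_of_isEquilChart`: every equilibrium chart is
Barlow-charted), the pinned form (A0♭⁺′) `EquilChartBondIsoPinnedP` with (A0♭⁺′) ⇒ (A0♭⁺), (A0♭⁺′) ⇒ (B1), (A0♭⁺′) ⇒ (B2) PROVED (so no piece exceeds the
pinned target), columns `_16XH10` / `_16XH10W` (19 leaves; supersede `_16XH9`).  Node memo: `NODE-g35-TransplantAndPin.md`.
0 EQUIV; placeholder-free; no type-class declarations, custom syntax or option pragmas.
-/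

noncomputable section

open scoped BigOperators InnerProductSpace RealInnerProductSpace
open MeasureTheory Set Metric Filter Topology
open Summit.AtomisticToContinuum.Crystallization.Theorems.ChartedPlanarOrderRigidityDoor
  (E3 IsClean IsNash IsCharted IsEStarGSC VisibleGap PertRegime atomsIn siteEnergy eStar BindingSurface)
open Summit.AtomisticToContinuum.Crystallization.Theorems.ChartedPlanarOrderDensityDichotomy (μS IsSep nK nK_nonneg excess)
open Summit.AtomisticToContinuum.Crystallization.Theorems.ChartedPlanarOrderMesoCut (IsDoorSet NearHom LayeredHom EnvClose)
open Summit.AtomisticToContinuum.Crystallization.Theorems.OverbindingBudgetLiouvilleDictionary (NearHomBD)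
open Summit.AtomisticToContinuum.Crystallization.Theorems.ChartedPlanarOrderDoorLayered
  (TwoPeriodic DoorPeriodic PeriodicBulkGapDoor gap_and_pert_1_50_of_periodic NearHomL2BD nearHomL2BD_mono nearHomBD_of_nearHomL2BD
   sq_le_finsum_mem not_nearHomL2BD_singleton envClose_mono Layered layeredHom_eq_layered atomsIn_subset)
open Summit.AtomisticToContinuum.Crystallization.Theorems.ChartedPlanarOrderDoorLayeredOsc (IsTwoShellAffineGood DoorPeriodicOsc)
open Summit.AtomisticToContinuum.Crystallization.Theorems.ChartedPlanarOrderCleanScaleP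
  (IsCleanP IsDoorSetP DoorPeriodicP isDoorSetP_mono doorPeriodic_of_doorPeriodicP isDoorSetP_one_iff doorPeriodicP_one_iff isCleanP_μS_iff)
open Summit.AtomisticToContinuum.Crystallization.Theorems.ChartedPlanarOrderCleanStackedIndependent (setOf_μS_ne_zero)
open Summit.AtomisticToContinuum.Crystallization.Theorems.ChartedPlanarOrderProfileSlavingLJ (pairForce)
open Summit.AtomisticToContinuum.Crystallization.Theorems.ChartedPlanarOrderBarlowGluing (barlowGluingW_holds)
open Literature.MathematicalPhysics.StatisticalMechanics
  (haggLabel barlowOffset layerNormal IsHaggSeq triangularVec₁ triangularVec₂ barlowStacking UniformlyDiscrete)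
open Literature.Geometry.DiscreteGeometry (IsTwoShellGoodSet)

namespace Summit.AtomisticToContinuum.Crystallization.Theorems.ChartedZeroExcessLayeredLatticeLiouville

/-! ## §XI  (lens-2 g35, node «TransplantAndPin» beneath (A0♭⁺)): (A0♭⁺) ⟸ (B1) `WordTransplantP` ∧ (B2) `BondIsoPinningP` ∧ (B4) `BondIsoTearFreeP`

### XI.1  Why this cut (and not «compose-and-pin with levels»)
(A0♭⁺) asks for ONE equilibrium chart `H` and ONE map `Ψ₀ : S → H` that is a bijective bond isomorphism, two-sided tear-free, AND registers `win R` at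
level `C♭·η`.  Three kinds of content hide in it, and they separate cleanly once every piece is stated over the lattice `L` of the scale-`R` hypothesis
chart (the datum `(L, w′, Ψ′, τ′)` that the multi-scale hypothesis provides at `D = R` — quantified universally, so the pieces compose without choice):
EXISTENCE of an equilibrium chart on `L` with `S`'s global word (B1: the residual; its only risk is the clean-window edge sliver of part TE/g33 §3, now for
the lattice `L` that actually registers `S` at scale `R`); PINNING of a bond isomorphism to the physical registration (B2: an ESTIMATE with no existence
content — the intrinsic labelling of a bond isomorphism is near-identity wherever `S`'s environment misfit to the `L`-ideal one is small, the misfits are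
summed by the registration level through affine-fit rigidity, the anchor is moved by a contact-graph automorphism and a translation of the chart, positions
follow by discrete Poincaré at scale `R`); TEAR-FREENESS (B4: contact-graph geometry of clean sets — a pair at distance `≤ 4` is joined by `≤ 7` bonds, and
`7·(28/25) ≤ 8`).  The literal «Ψ₀ := Φ_H ∘ Φ_S⁻¹ pinned to Ψ_R where τ_R < 1/5» of the g34 memo §5 compares maps into two DIFFERENT charts (the hypothesis
chart `H′ = LayeredHom L w′` and the transplanted `H = LayeredHom L w`) and is exactly (B2)'s content, not bookkeeping; what IS bookkeeping — the passage
between the two currencies «Barlow chart by a word» (`IsCharted`) and «bijective bond isomorphism» (`IsBondIso`) — is PROVED here (D1, D2), and so is the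
model side «every equilibrium chart is Barlow-charted» (lens-3 `barlowGluingW_holds`).
| piece | type | status / tag | why strictly weaker than (A0♭⁺′) | size |
|---|---|---|---|---|
| (B1) `WordTransplantP` | EXISTENCE (S-dependent: the word is `S`'s; chart-level only — no map to `S`, no level) | WEAKER ((A0♭⁺′) ⇒ (B1) PROVED) · TRUE-expected off the edge slivers · UNDECIDED · INSTRUMENTABLE (layer chain) | no registration, no tear-freeness asked | M |
| (B2) `BondIsoPinningP` | PINNING / RIGIDITY ESTIMATE at the single scale `R` for a GIVEN bond isomorphism (re-anchoring allowed) | WEAKER ((A0♭⁺′) ⇒ (B2) PROVED) · TRUE-type · ATTACKABLE | assumes the chart and a bond isomorphism exist | M–L |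
| (B4) `BondIsoTearFreeP` | GEOMETRY of clean contact graphs (no chart, no level, no `S`-dependence beyond cleanliness) | TRUE-type · ATTACKABLE | a statement about ALL bond isomorphisms of clean sets | M |
Skeleton of (B2): S1 label truth (a bijective bond isomorphism restricted to a first shell of a clean site is the pattern correspondence; where the
misfit of `S`'s environment to the `L`-ideal environment is `< 1/8` the intrinsic labelling is the near-identity one and propagates across bonds) · S2 misfit
sum `Σ_{win R} misfit² ≤ C·Σ τ′² ≤ C·η·nK` (the hypothesis registration certifies orientation `≈ L` in mean square; affine-fit rigidity [kruzik2019 Thm 1.1.12])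
· S3 re-anchoring (`Ψ₁ := σ ∘ Ψ₀`, `σ` a contact-graph automorphism of `H` composed with a translation `w ↦ w + t`; equilibrium charts are translation
invariant; symmetric islands of `Ψ′` are harmless because `Ψ₁`'s profile is intrinsic to `S`) · S4 positions by discrete Poincaré on the contact graph of
`win R` anchored at one site (`≤ C·R²·η·nK`) · S5 packaging by `isRegistered_of_bijOn_dominating` (part TG, PROVED; its reverse-tear-free input is (B4)).
Skeleton of (B4): T1 greedy first-shell walk (the 12 first-shell directions of a clean site are within `45°` of every direction, each step of length
`≥ 27/32` gains `≥ 0.55` towards the target while the distance exceeds `3a/2`) · T2 the last `3a/2`: the target is a pattern point, first shell = 1 bond,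
second shell = 2 bonds · T3 `≤ 7` bonds of length `≤ 28/25` each in the image.
-/

/-! ### XI.2  The two currencies and their dictionary (PROVED) -/

/-- ★ **Barlow chart with explicit word and map** `IsBarlowChart sw Φ Y`: `Φ` is a bijection from the ideal Barlow stacking of the Hägg word `sw` (unit
spacing, ideal height `√(2/3)`) onto `Y` carrying unit contacts exactly onto `(0, 28/25]`-pairs — the data of `IsCharted (μS Y)` made explicit
(`isCharted_μS_iff_exists_barlowChart`). [this file, g35] -/
def IsBarlowChart (sw : ℤ → ℤ) (Φ : E3 → E3) (Y : Set E3) : Prop :=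
  Set.BijOn Φ (barlowStacking 1 (Real.sqrt (2 / 3)) sw) Y ∧
    ∀ p ∈ barlowStacking 1 (Real.sqrt (2 / 3)) sw, ∀ q ∈ barlowStacking 1 (Real.sqrt (2 / 3)) sw,
      (dist p q = 1 ↔ (0 < dist (Φ p) (Φ q) ∧ dist (Φ p) (Φ q) ≤ 28 / 25))

/-- `IsCharted (μS Y)` is the existence of a Hägg word and a Barlow chart of `Y` (the atoms of `μS Y` are the points of `Y`). [this file, g35] -/
theorem isCharted_μS_iff_exists_barlowChart (Y : Set E3) :
    IsCharted (μS Y) ↔ ∃ sw : ℤ → ℤ, IsHaggSeq sw ∧ ∃ Φ : E3 → E3, IsBarlowChart sw Φ Y := by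
  simp only [IsCharted, IsBarlowChart, setOf_μS_ne_zero]

/-- ★ **D1 (PROVED): two configurations Barlow-charted by the SAME word are bijectively bond-isomorphic** — `Ψ := Φ_H ∘ Φ_S⁻¹`; a pair of distinct
sites is a bond of `S` iff its `Φ_S`-preimage is a unit contact iff its `Ψ`-image is a bond of `H`. This is the «compose» step of the memo, and the
reason (B1) may be stated at chart level. [this file, g35] -/
theorem exists_bijOn_bondIso_of_barlowCharts {sw : ℤ → ℤ} {Φ ΦH : E3 → E3} {S H : Set E3} (hS : IsBarlowChart sw Φ S)
    (hH : IsBarlowChart sw ΦH H) : ∃ Ψ : E3 → E3, Set.BijOn Ψ S H ∧ IsBondIso S Ψ := by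
  classical
  obtain ⟨hbS, hdS⟩ := hS
  obtain ⟨hbH, hdH⟩ := hH
  set B : Set E3 := barlowStacking 1 (Real.sqrt (2 / 3)) sw
  have hinv : Set.InvOn (Function.invFunOn Φ B) Φ B S := hbS.invOn_invFunOn
  have hbinv : Set.BijOn (Function.invFunOn Φ B) S B := hbS.symm hinv.symm
  refine ⟨ΦH ∘ Function.invFunOn Φ B, hbH.comp hbinv, fun x hx p hp => ?_⟩
  have hp' : Function.invFunOn Φ B p ∈ B := hbinv.mapsTo hp
  have hx' : Function.invFunOn Φ B x ∈ B := hbinv.mapsTo hx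
  have hΦp : Φ (Function.invFunOn Φ B p) = p := hinv.2 hp
  have hΦx : Φ (Function.invFunOn Φ B x) = x := hinv.2 hx
  by_cases hpx : p = x
  · subst hpx
    simp only [dist_self]
  · have hne : (ΦH ∘ Function.invFunOn Φ B) p ≠ (ΦH ∘ Function.invFunOn Φ B) x :=
      fun h => hpx ((hbH.comp hbinv).injOn hp hx h)
    have key := (hdS _ hp' _ hx').symm.trans (hdH _ hp' _ hx')
    rw [hΦp, hΦx] at key
    simp only [Function.comp_apply] at hne ⊢
    exact ⟨fun h => (key.1 ⟨dist_pos.2 hpx, h⟩).2, fun h => (key.2 ⟨dist_pos.2 hne, h⟩).2⟩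

/-- ★ **D2 (PROVED): a bijective bond isomorphism transports a Barlow chart** — `Ψ ∘ Φ` charts `H` by the SAME word (bonds go to bonds both ways;
distinctness is preserved by injectivity). The «pin the word» step of the memo: the chart (A0♭⁺) produces carries `S`'s own word. [this file, g35] -/
theorem IsBarlowChart.transport {sw : ℤ → ℤ} {Φ Ψ : E3 → E3} {S H : Set E3} (hS : IsBarlowChart sw Φ S) (hbij : Set.BijOn Ψ S H)
    (hiso : IsBondIso S Ψ) : IsBarlowChart sw (Ψ ∘ Φ) H := by
  refine ⟨hbij.comp hS.1, fun p hp q hq => (hS.2 p hp q hq).trans ?_⟩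
  have hΦp : Φ p ∈ S := hS.1.mapsTo hp
  have hΦq : Φ q ∈ S := hS.1.mapsTo hq
  have hb := hiso (Φ q) hΦq (Φ p) hΦp
  simp only [Function.comp_apply]
  constructor
  · rintro ⟨h0, h1⟩
    exact ⟨dist_pos.2 fun h => (dist_pos.1 h0) (hbij.injOn hΦp hΦq h), hb.1 h1⟩
  · rintro ⟨h0, h1⟩
    exact ⟨dist_pos.2 fun h => (dist_pos.1 h0) (congrArg Ψ h), hb.2 h1⟩

/-- ★ **(PROVED) a configuration bijectively bond-isomorphic to a charted one is charted BY THE SAME WORD** (D2 through the dictionary). [this file, g35] -/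
theorem isCharted_of_bijOn_bondIso {S H : Set E3} {Ψ : E3 → E3} (hS : IsCharted (μS S)) (hbij : Set.BijOn Ψ S H) (hiso : IsBondIso S Ψ) :
    IsCharted (μS H) := by
  rw [isCharted_μS_iff_exists_barlowChart] at hS ⊢
  obtain ⟨sw, hsw, Φ, hΦ⟩ := hS
  exact ⟨sw, hsw, Ψ ∘ Φ, hΦ.transport hbij hiso⟩

/-! ### XI.3  Model charting from lens-3 (PROVED): every equilibrium chart is Barlow-charted -/

/-- clean configurations are uniformly discrete (part TF `isSep_of_isClean`: `27/32`-separated). [this file, g35] -/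
theorem uniformlyDiscrete_of_isClean {Y : Set E3} (hC : IsClean (μS Y)) : UniformlyDiscrete Y :=
  ⟨27 / 32, by norm_num, isSep_of_isClean hC⟩

/-- ★ **(PROVED, via lens-3 `barlowGluingW_holds`) a ROOTED clean configuration is Barlow-charted**: cleanliness `(1/16, 9/10, 1)` is two-shell goodness
at every site in the window `[9/10, 103/100]`, and the set is uniformly discrete. [this file, g35; lens-3 `ChartedPlanarOrderBarlowGluing`] -/
theorem isCharted_μS_of_isClean {Y : Set E3} (h0 : (0 : E3) ∈ Y) (hC : IsClean (μS Y)) : IsCharted (μS Y) :=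
  barlowGluingW_holds Y h0 (uniformlyDiscrete_of_isClean hC) fun q hq =>
    (((isCleanP_μS_iff (aHi := 1) Y).1 hC) q hq).mono_window le_rfl (by norm_num)

/-- two-shell goodness of a site in a set is invariant under a common translation. [folklore] -/
theorem isTwoShellGoodSet_translate {ε lo hi : ℝ} {Y : Set E3} {q : E3} (v : E3) (h : IsTwoShellGoodSet ε lo hi Y q) :
    IsTwoShellGoodSet ε lo hi ((fun p => p + v) '' Y) (q + v) := by
  obtain ⟨a, ha₁, ha₂, A, P, f, hP, hf, hinj, hcov⟩ := h
  refine ⟨a, ha₁, ha₂, A, P, fun w => f w + v, hP, fun w hw => ⟨⟨f w, (hf w hw).1, rfl⟩, ?_⟩,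
    fun w hw w' hw' he => hinj hw hw' (add_right_cancel he), ?_⟩
  · rw [add_right_comm q v, dist_add_right]
    exact (hf w hw).2
  · rintro y ⟨y₀, hy₀, rfl⟩ hne hd
    have hne₀ : y₀ ≠ q := fun e => hne (by rw [e])
    rw [dist_add_right] at hd
    obtain ⟨w, hw, hfw⟩ := hcov y₀ hy₀ hne₀ hd
    exact ⟨w, hw, by simp only [hfw]⟩

/-- chartedness is invariant under translation (translate the chart). [folklore] -/
theorem isCharted_μS_translate {Y : Set E3} (v : E3) (h : IsCharted (μS Y)) : IsCharted (μS ((fun p => p + v) '' Y)) := by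
  rw [isCharted_μS_iff_exists_barlowChart] at h ⊢
  obtain ⟨sw, hsw, Φ, hb, hd⟩ := h
  refine ⟨sw, hsw, (fun p => p + v) ∘ Φ, (add_left_injective v).injOn.bijOn_image.comp hb, fun p hp q hq => ?_⟩
  simp only [Function.comp_apply, dist_add_right]
  exact hd p hp q hq

/-- ★★ **MODEL CHARTING (PROVED): every equilibrium chart is Barlow-charted** — the model set `LayeredHom L w` of an `IsEquilChart` is clean, hence
(rooted at its site `w 0` by a translation) charted by lens-3's gluing theorem.  This is the critic's piece B2 (row 587 (A)(4), row 576 (A)(1)) in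
closed form; (B1) below asks for the chart whose word is `S`'s. [this file, g35] -/
theorem isCharted_of_isEquilChart {a s Λ : ℝ} {L : E3 ≃L[ℝ] E3} {w : ℤ → E3} (h : IsEquilChart a s Λ L w) :
    IsCharted (μS (LayeredHom (L : E3 →L[ℝ] E3) w)) := by
  have hC : IsClean (μS (LayeredHom (L : E3 →L[ℝ] E3) w)) := h.2.2.2.1
  have hw0 : w 0 ∈ LayeredHom (L : E3 →L[ℝ] E3) w := ⟨0, 0, 0, by simp⟩
  have hgood := (isCleanP_μS_iff (aHi := 1) (LayeredHom (L : E3 →L[ℝ] E3) w)).1 hC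
  have hC' : IsClean (μS ((fun p => p + -w 0) '' LayeredHom (L : E3 →L[ℝ] E3) w)) :=
    (isCleanP_μS_iff (aHi := 1) _).2 (by
      rintro q ⟨q₀, hq₀, rfl⟩
      exact isTwoShellGoodSet_translate (-w 0) (hgood q₀ hq₀))
  have h0 : (0 : E3) ∈ (fun p => p + -w 0) '' LayeredHom (L : E3 →L[ℝ] E3) w := ⟨w 0, hw0, add_neg_cancel (w 0)⟩
  simpa only [Set.image_image, neg_add_cancel_right, Set.image_id'] using
    isCharted_μS_translate (w 0) (isCharted_μS_of_isClean h0 hC')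

/-! ### XI.4  The pieces -/

/-- ★★ **(B1) «WordTransplantP aHi Λ θ s»** — THE EXISTENCE RESIDUAL of (A0♭⁺): for every `δ, a` there are a ceiling `η₁` and a floor `R₁` such that,
for a θ-good door set `S` that is `η`-registered-flat to equilibrium charts at every scale `D ≥ R` (`η ≤ η₁`, `R ≥ R₁`), EVERY equilibrium chart
`(L, w′)` registering the window `win R` at level `η` (by any `Ψ′, τ′`) has, ON THE SAME LATTICE `L`, interlayer data `w` with `LayeredHom L w` again an
equilibrium chart (clean, Nash; conformality and the norm bounds are `L`'s) that is Barlow-charted by `S`'s OWN Hägg word `sw` (whichever chart `(sw, Φ)` of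
`S` is presented).  Chart level only: no map to `S`, no registration, no tear-freeness — those are (B2), (B4).  EXISTENCE-type · S-dependent (the word) ·
WEAKER ((A0♭⁺′) ⇒ (B1), `wordTransplantP_of_pinned`, PROVED) · TRUE-expected · UNDECIDED · INSTRUMENTABLE.  Mechanism: 1-D layer chain on `L` — the
equilibrium offsets of the hypothesis chart's word are continued to `S`'s word by the implicit-function theorem (chain Hessian `λ_min ≥ 16.9` uniformly in
the word and in `|a/d₀ − 1| ≤ 6 %`, g33 §3), each flipped Hägg letter being a point reflection of a half-stack (a symmetry of `L`'s layer lattice for EVERY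
linear `L`) followed by an exponentially small re-relaxation; cleanliness margin `0.06` against corrections `≤ 10⁻³`; every equilibrium chart is
Barlow-charted by SOME word already (`isCharted_of_isEquilChart`, PROVED).
Why it might fail: the equilibrium of `S`'s global word must be CLEAN on exactly the lattice `L` that registers `S` at scale `R` — on the clean-window edge
slivers `d ∈ (1.03393, 1.03406) ∪ (0.90902, 0.90904)` (g33 §3) a door set with drifting local lattice could be clean while the homogeneous equilibrium on
its scale-`R` lattice is not (the ceiling `η₁(a)` must keep `L` off the slivers).
Sources: [this tree: `IsEquilChart`, `IsRegistered`, `IsCharted`, `homStacking_eq_layeredHom`, lens-3 `barlowGluingW_holds`], [EMing2006 §2],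
[ConwaySloane1999 Ch. 1 §1.3], [g33 instrument `layerchain.py` run24]. [this file, g35] -/
def WordTransplantP (aHi Λ θ s : ℝ) : Prop :=
  ∀ δ : ℝ, 0 < δ → ∀ a : ℝ, 0 < a → ∃ η₁ : ℝ, 0 < η₁ ∧ ∃ R₁ : ℝ, 0 < R₁ ∧
    ∀ S : Set E3, IsDoorSetP aHi δ S → (∀ q ∈ S, IsTwoShellAffineGood θ S q) →
      ∀ η : ℝ, 0 < η → η ≤ η₁ → ∀ R : ℝ, R₁ ≤ R →
        (∀ D : ℝ, R ≤ D → NearHomH1BDE a s Λ η 4 D S (atomsIn (μS S) 0 D)) →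
          ∀ (L : E3 ≃L[ℝ] E3) (w' : ℤ → E3) (Ψ' : E3 → E3) (τ' : E3 → ℝ), IsEquilChart a s Λ L w' →
            IsRegistered η 4 R S (atomsIn (μS S) 0 R) (LayeredHom (L : E3 →L[ℝ] E3) w') Ψ' τ' →
              ∀ (sw : ℤ → ℤ) (Φ : E3 → E3), IsHaggSeq sw → IsBarlowChart sw Φ S →
                ∃ (w : ℤ → E3) (ΦH : E3 → E3), IsEquilChart a s Λ L w ∧ IsBarlowChart sw ΦH (LayeredHom (L : E3 →L[ℝ] E3) w)

/-- ★★ **(B2) «BondIsoPinningP aHi Λ θ s»** — THE PINNING ESTIMATE of (A0♭⁺): for every `δ, a` there is `C♭ ≥ 1` (ceiling `η₁`, floor `R₁`) such that: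
GIVEN the scale-`R` datum `(L, w′, Ψ′, τ′)` (an equilibrium chart registering `win R` at level `η`) AND an equilibrium chart `LayeredHom L w` ON THE SAME
LATTICE together with a bijective bond isomorphism `Ψ₀ : S → LayeredHom L w` (exactly what (B1) + D1 produce), there are RE-ANCHORED data — interlayer
offsets `w₁` on `L` (still an equilibrium chart) and a bijective bond isomorphism `Ψ₁ : S → LayeredHom L w₁` — such that `Ψ₁` registers `win R` at level
`C♭·η` (part Q `IsRegistered`, radius `4`, position scale `R`).  Intended `w₁ := w + t`, `Ψ₁ := (· + t) ∘ σ ∘ Ψ₀` with `σ` a contact-graph automorphism of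
the model.  No existence content (the chart and the isomorphism are given); no level beyond scale `R` (that is (A0♯⁺) of part TG).  PINNING / RIGIDITY
ESTIMATE · TRUE-type · WEAKER ((A0♭⁺′) ⇒ (B2), `bondIsoPinningP_of_pinned`, PROVED) · ATTACKABLE · M–L (skeleton S1–S5 of §XI.1).
Why it might fail: the misfit sum S2 needs an affine-fit rigidity constant uniform over clean environments, and the intrinsic labelling S1 must stay
near-identity across sites of misfit `≥ 1/8` (at most `64·η·nK` of them) without the good region disconnecting inside `win R`.
Sources: [this tree: `IsRegistered`, `isRegistered_of_bijOn_dominating` (TG), `IsBondIso`, `nash_force_balance`], [kruzik2019 p.55 Thm 1.1.12 (FJM rigidity)],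
[Theil2006 §3], [EMing2006 §2]. [this file, g35] -/
def BondIsoPinningP (aHi Λ θ s : ℝ) : Prop :=
  ∀ δ : ℝ, 0 < δ → ∀ a : ℝ, 0 < a → ∃ Cb : ℝ, 1 ≤ Cb ∧ ∃ η₁ : ℝ, 0 < η₁ ∧ ∃ R₁ : ℝ, 0 < R₁ ∧
    ∀ S : Set E3, IsDoorSetP aHi δ S → (∀ q ∈ S, IsTwoShellAffineGood θ S q) →
      ∀ η : ℝ, 0 < η → η ≤ η₁ → ∀ R : ℝ, R₁ ≤ R →
        (∀ D : ℝ, R ≤ D → NearHomH1BDE a s Λ η 4 D S (atomsIn (μS S) 0 D)) →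
          ∀ (L : E3 ≃L[ℝ] E3) (w' : ℤ → E3) (Ψ' : E3 → E3) (τ' : E3 → ℝ), IsEquilChart a s Λ L w' →
            IsRegistered η 4 R S (atomsIn (μS S) 0 R) (LayeredHom (L : E3 →L[ℝ] E3) w') Ψ' τ' →
              ∀ (w : ℤ → E3) (Ψ₀ : E3 → E3), IsEquilChart a s Λ L w → Set.BijOn Ψ₀ S (LayeredHom (L : E3 →L[ℝ] E3) w) → IsBondIso S Ψ₀ →
                ∃ (w₁ : ℤ → E3) (Ψ₁ : E3 → E3), IsEquilChart a s Λ L w₁ ∧ Set.BijOn Ψ₁ S (LayeredHom (L : E3 →L[ℝ] E3) w₁) ∧ IsBondIso S Ψ₁ ∧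
                  ∃ τ₁ : E3 → ℝ, IsRegistered (Cb * η) 4 R S (atomsIn (μS S) 0 R) (LayeredHom (L : E3 →L[ℝ] E3) w₁) Ψ₁ τ₁

/-- ★★ **(B4) «BondIsoTearFreeP aHi»** — TEAR-FREENESS IS AUTOMATIC FOR BOND ISOMORPHISMS OF CLEAN SETS: a bijection `Ψ : S → H` between an `aHi`-clean
configuration `S` and a clean `H` that preserves and reflects bonds (`IsBondIso`) is two-sided tear-free at `4 ↦ 8`: two sites of a clean set at distance
`≤ 4` are joined by a path of `≤ 7` bonds (greedy first-shell walk, T1–T3 of §XI.1), whose image is a path of `≤ 7` bonds, each of length `≤ 28/25`, so of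
total length `≤ 7.84 ≤ 8`; symmetrically backwards.  GEOMETRY · TRUE-type · ATTACKABLE · M.  Used at the literal `aHi = 1`.
Why it might fail: only through the constants — the bond-path count `7` needs every direction to be within `45°` of a first-shell direction of a
`(1/16, 9/10, aHi)`-good site and the step gain `≥ 0.55`; at `aHi = 1` the margins are `7.84 < 8` and `6` steps from distance `4`.
Sources: [this tree: `IsTwoShellGoodSet`, `fccTwoShellPattern`, `hcpTwoShellPattern`, `isSep_of_isClean` (TF), `exists_walk` (lens-3)],
[ConwaySloane1999 Ch. 1 §1.3 (cuboctahedron / anticuboctahedron)]. [this file, g35] -/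
def BondIsoTearFreeP (aHi : ℝ) : Prop :=
  ∀ S H : Set E3, IsCleanP aHi (μS S) → IsClean (μS H) → ∀ Ψ : E3 → E3, Set.BijOn Ψ S H → IsBondIso S Ψ →
    (∀ x ∈ S, ∀ p ∈ S, dist p x ≤ 4 → dist (Ψ p) (Ψ x) ≤ 8) ∧ (∀ x ∈ S, ∀ p ∈ S, dist (Ψ p) (Ψ x) ≤ 4 → dist p x ≤ 8)

/-- ★★ **(A0♭⁺′) «EquilChartBondIsoPinnedP aHi Λ θ s»** — the PINNED FORM of (A0♭⁺) (evidence device, one notch stronger): the conclusion of (A0♭⁺)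
holds ON THE LATTICE `L` OF EVERY scale-`R` datum `(L, w′, Ψ′, τ′)`, not merely for some chart.  (A0♭⁺′) ⇒ (A0♭⁺) (`equilChartBondIsoP_of_pinned`: take the
datum the multi-scale hypothesis provides at `D = R`), (A0♭⁺′) ⇒ (B1), (A0♭⁺′) ⇒ (B2) (PROVED), and (B1) ∧ (B2) ∧ (B4) ⇒ (A0♭⁺′) (PROVED): the node's
pieces are consequences of the pinned target, so none is stronger than what the line must prove anyway.  EXISTENCE + PINNING · UNDECIDED. [this file, g35] -/
def EquilChartBondIsoPinnedP (aHi Λ θ s : ℝ) : Prop :=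
  ∀ δ : ℝ, 0 < δ → ∀ a : ℝ, 0 < a → ∃ Cb : ℝ, 1 ≤ Cb ∧ ∃ η₁ : ℝ, 0 < η₁ ∧ ∃ R₁ : ℝ, 0 < R₁ ∧
    ∀ S : Set E3, IsDoorSetP aHi δ S → (∀ q ∈ S, IsTwoShellAffineGood θ S q) →
      ∀ η : ℝ, 0 < η → η ≤ η₁ → ∀ R : ℝ, R₁ ≤ R →
        (∀ D : ℝ, R ≤ D → NearHomH1BDE a s Λ η 4 D S (atomsIn (μS S) 0 D)) →
          ∀ (L : E3 ≃L[ℝ] E3) (w' : ℤ → E3) (Ψ' : E3 → E3) (τ' : E3 → ℝ), IsEquilChart a s Λ L w' →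
            IsRegistered η 4 R S (atomsIn (μS S) 0 R) (LayeredHom (L : E3 →L[ℝ] E3) w') Ψ' τ' →
              ∃ (w : ℤ → E3), IsEquilChart a s Λ L w ∧
                ∃ Ψ₀ : E3 → E3, Set.BijOn Ψ₀ S (LayeredHom (L : E3 →L[ℝ] E3) w) ∧ IsBondIso S Ψ₀ ∧
                  (∀ x ∈ S, ∀ p ∈ S, dist p x ≤ 4 → dist (Ψ₀ p) (Ψ₀ x) ≤ 8) ∧ (∀ x ∈ S, ∀ p ∈ S, dist (Ψ₀ p) (Ψ₀ x) ≤ 4 → dist p x ≤ 8) ∧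
                  ∃ τ : E3 → ℝ, IsRegistered (Cb * η) 4 R S (atomsIn (μS S) 0 R) (LayeredHom (L : E3 →L[ℝ] E3) w) Ψ₀ τ

/-! ### XI.5  Glue, projections, columns (PROVED) -/

/-- a door set presents a Barlow chart (its `IsCharted` clause, unpacked). [this file, g35] -/
theorem exists_barlowChart_of_isDoorSetP {aHi δ : ℝ} {S : Set E3} (hS : IsDoorSetP aHi δ S) :
    ∃ sw : ℤ → ℤ, IsHaggSeq sw ∧ ∃ Φ : E3 → E3, IsBarlowChart sw Φ S :=
  (isCharted_μS_iff_exists_barlowChart S).1 hS.2.2.2.2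

/-- ★★ **(B1) ∧ (B2) ∧ (B4) ⇒ (A0♭⁺′) (PROVED)** — the node's glue in pinned form: on the datum's lattice `L`, (B1) transplants `S`'s word (chart level), D1
turns the common word into a bijective bond isomorphism, (B2) re-anchors it into a registration of `win R` at level `C♭·η`, (B4) makes it two-sided
tear-free (both sets are clean: `S` is a door set, the model is an equilibrium chart). Ceiling `min`, floor `max`. [this file, g35] -/
theorem equilChartBondIsoPinnedP_of_pieces {aHi Λ θ s : ℝ} (h1 : WordTransplantP aHi Λ θ s) (h2 : BondIsoPinningP aHi Λ θ s)
    (h4 : BondIsoTearFreeP aHi) : EquilChartBondIsoPinnedP aHi Λ θ s := by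
  intro δ hδ a ha
  obtain ⟨η₁, hη₁, R₁, hR₁, H1⟩ := h1 δ hδ a ha
  obtain ⟨Cb, hCb, η₂, hη₂, R₂, hR₂, H2⟩ := h2 δ hδ a ha
  refine ⟨Cb, hCb, min η₁ η₂, lt_min hη₁ hη₂, max R₁ R₂, lt_max_of_lt_left hR₁, ?_⟩
  intro S hS hgood η hη hηle R hR hms L w' Ψ' τ' hE' hreg'
  obtain ⟨sw, hsw, Φ, hΦ⟩ := exists_barlowChart_of_isDoorSetP hS
  obtain ⟨w, ΦH, hEw, hΦH⟩ := H1 S hS hgood η hη (hηle.trans (min_le_left _ _)) R ((le_max_left _ _).trans hR) hms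
    L w' Ψ' τ' hE' hreg' sw Φ hsw hΦ
  obtain ⟨Ψ₀, hbij₀, hiso₀⟩ := exists_bijOn_bondIso_of_barlowCharts hΦ hΦH
  obtain ⟨w₁, Ψ₁, hEw₁, hbij₁, hiso₁, τ₁, hreg₁⟩ := H2 S hS hgood η hη (hηle.trans (min_le_right _ _)) R ((le_max_right _ _).trans hR) hms
    L w' Ψ' τ' hE' hreg' w Ψ₀ hEw hbij₀ hiso₀
  obtain ⟨ht1, ht2⟩ := h4 S _ hS.2.2.1 hEw₁.2.2.2.1 Ψ₁ hbij₁ hiso₁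
  exact ⟨w₁, hEw₁, Ψ₁, hbij₁, hiso₁, ht1, ht2, τ₁, hreg₁⟩

/-- ★ **(A0♭⁺′) ⇒ (A0♭⁺) (PROVED)**: apply the pinned form to the datum the multi-scale hypothesis provides at `D = R`. [this file, g35] -/
theorem equilChartBondIsoP_of_pinned {aHi Λ θ s : ℝ} (h : EquilChartBondIsoPinnedP aHi Λ θ s) : EquilChartBondIsoP aHi Λ θ s := by
  intro δ hδ a ha
  obtain ⟨Cb, hCb, η₁, hη₁, R₁, hR₁, H⟩ := h δ hδ a ha
  refine ⟨Cb, hCb, η₁, hη₁, R₁, hR₁, fun S hS hgood η hη hηle R hR hms => ?_⟩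
  obtain ⟨L, w', hE', Ψ', τ', hreg'⟩ := hms R le_rfl
  obtain ⟨w, hEw, rest⟩ := H S hS hgood η hη hηle R hR hms L w' Ψ' τ' hE' hreg'
  exact ⟨L, w, hEw, rest⟩

/-- ★★ **(A0♭⁺) ⟸ (B1) ∧ (B2) ∧ (B4) (PROVED)** — the node's glue (through the pinned form). [this file, g35] -/
theorem equilChartBondIsoP_of_pieces {aHi Λ θ s : ℝ} (h1 : WordTransplantP aHi Λ θ s) (h2 : BondIsoPinningP aHi Λ θ s)
    (h4 : BondIsoTearFreeP aHi) : EquilChartBondIsoP aHi Λ θ s :=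
  equilChartBondIsoP_of_pinned (equilChartBondIsoPinnedP_of_pieces h1 h2 h4)

/-- ★ **(A0♭⁺′) ⇒ (B1) (PROVED)**: the pinned target's bond isomorphism transports `S`'s presented chart to the model (D2) — so (B1) asks no more
than the line must deliver. [this file, g35] -/
theorem wordTransplantP_of_pinned {aHi Λ θ s : ℝ} (h : EquilChartBondIsoPinnedP aHi Λ θ s) : WordTransplantP aHi Λ θ s := by
  intro δ hδ a ha
  obtain ⟨Cb, -, η₁, hη₁, R₁, hR₁, H⟩ := h δ hδ a ha
  refine ⟨η₁, hη₁, R₁, hR₁, fun S hS hgood η hη hηle R hR hms L w' Ψ' τ' hE' hreg' sw Φ _ hΦ => ?_⟩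
  obtain ⟨w, hEw, Ψ₀, hbij, hiso, -⟩ := H S hS hgood η hη hηle R hR hms L w' Ψ' τ' hE' hreg'
  exact ⟨w, Ψ₀ ∘ Φ, hEw, hΦ.transport hbij hiso⟩

/-- ★ **(A0♭⁺′) ⇒ (B2) (PROVED)**: ignore the presented pair and hand back the pinned target's registered one. [this file, g35] -/
theorem bondIsoPinningP_of_pinned {aHi Λ θ s : ℝ} (h : EquilChartBondIsoPinnedP aHi Λ θ s) : BondIsoPinningP aHi Λ θ s := by
  intro δ hδ a ha
  obtain ⟨Cb, hCb, η₁, hη₁, R₁, hR₁, H⟩ := h δ hδ a ha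
  refine ⟨Cb, hCb, η₁, hη₁, R₁, hR₁, fun S hS hgood η hη hηle R hR hms L w' Ψ' τ' hE' hreg' _ _ _ _ _ => ?_⟩
  obtain ⟨w, hEw, Ψ₀, hbij, hiso, -, -, τ, hτ⟩ := H S hS hgood η hη hηle R hR hms L w' Ψ' τ' hE' hreg'
  exact ⟨w, Ψ₀, hEw, hbij, hiso, τ, hτ⟩

/-- ★ **non-vacuity of (B2)'s input and of (B1)'s datum**: an equilibrium chart, as a configuration, carries both — it is Barlow-charted
(`isCharted_of_isEquilChart`), and the identity is a bijective bond isomorphism onto it registering every window at level `0` (part TG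
`bondIso_data_self`). [this file, g35] -/
theorem pinning_data_self {a s Λ : ℝ} {L : E3 ≃L[ℝ] E3} {w : ℤ → E3} (h : IsEquilChart a s Λ L w) (R : ℝ) :
    (∃ sw : ℤ → ℤ, IsHaggSeq sw ∧ ∃ Φ : E3 → E3, IsBarlowChart sw Φ (LayeredHom (L : E3 →L[ℝ] E3) w)) ∧
      Set.BijOn (fun x => x) (LayeredHom (L : E3 →L[ℝ] E3) w) (LayeredHom (L : E3 →L[ℝ] E3) w) ∧
      IsBondIso (LayeredHom (L : E3 →L[ℝ] E3) w) (fun x => x) ∧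
      ∃ τ : E3 → ℝ, IsRegistered 0 4 R (LayeredHom (L : E3 →L[ℝ] E3) w) (atomsIn (μS (LayeredHom (L : E3 →L[ℝ] E3) w)) 0 R)
        (LayeredHom (L : E3 →L[ℝ] E3) w) (fun x => x) τ :=
  ⟨(isCharted_μS_iff_exists_barlowChart _).1 (isCharted_of_isEquilChart h), Set.bijOn_id _, isBondIso_self _,
    fun _ => 0, isRegistered_self 4 R (atomsIn_subset _ R)⟩

/-- ★★★ **COLUMN `_16XH10` — NINETEEN opaque leaves** (the node's pieces in place of (A0♭⁺)):
`LatticeLiouvilleCert → LayeredLiouvilleCert → R_G → X → Z_E → P → T → U♮ → B1 → B2 → B4 → A0♯⁺ → FF → E → A⁰ → D⁰ → C♭ → R_W → PeriodicBulkGapDoor 2 →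
VisibleGap (1/50) ∧ PertRegime (1/50)` (all at `(aHi; Λ, θ, s) = (1; 2, 1/16, 1/50)`), via `_16XH9` with `hb := equilChartBondIsoP_of_pieces`.
Supersedes `_16XH9`.  Residual of record unchanged: (R_W) alone; residual of existence type on the (A0)-line: (B1) alone. [this file, g35] -/
theorem gap_and_pert_1_50_of_certs_16XH10 (hL : LatticeLiouvilleCert) (hL' : LayeredLiouvilleCert)
    (hR : OscRigidityL2BDPG 1 2 (1 / 16) (1 / 16)) (hX : ExcessFlatnessControlP 1 2 (1 / 16) (1 / 16))
    (hE : ExcessChartLocalisationP 1 2 (1 / 16) (1 / 50)) (hP : RegistrationP 1 2 (1 / 16) (1 / 50))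
    (hT : TailDominationCert) (hU : UniformTameStability (1 / 50) 2)
    (h1 : WordTransplantP 1 2 (1 / 16) (1 / 50)) (h2 : BondIsoPinningP 1 2 (1 / 16) (1 / 50)) (h4 : BondIsoTearFreeP 1)
    (hl : BondIsoLevelsP 1 2 (1 / 16) (1 / 50))
    (hF : TailForceSlavingP 1 2 (1 / 16) (1 / 50))
    (hE' : LipDualLinearisationP 1 2 (1 / 16) (1 / 50)) (hA : L2HarmonicApproxP 1 2 (1 / 16) (1 / 50))
    (hD : PositionDecayPL 1 2 (1 / 16) (1 / 50)) (hC : PositionCaccioppoliPG 1 2 (1 / 16) (1 / 50))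
    (hW : WildFractionPG 1 2 (1 / 16) (1 / 50)) (hG : PeriodicBulkGapDoor 2) : VisibleGap (1 / 50) ∧ PertRegime (1 / 50) :=
  gap_and_pert_1_50_of_certs_16XH9 hL hL' hR hX hE hP hT hU (equilChartBondIsoP_of_pieces h1 h2 h4) hl hF hE' hA hD hC hW hG

/-- ★ **COLUMN `_16XH10W`** — the same with (A1) «WildReRegistrationPG» in place of (R_W). [this file, g35] -/
theorem gap_and_pert_1_50_of_certs_16XH10W (hL : LatticeLiouvilleCert) (hL' : LayeredLiouvilleCert)
    (hR : OscRigidityL2BDPG 1 2 (1 / 16) (1 / 16)) (hX : ExcessFlatnessControlP 1 2 (1 / 16) (1 / 16))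
    (hE : ExcessChartLocalisationP 1 2 (1 / 16) (1 / 50)) (hP : RegistrationP 1 2 (1 / 16) (1 / 50))
    (hT : TailDominationCert) (hU : UniformTameStability (1 / 50) 2)
    (h1 : WordTransplantP 1 2 (1 / 16) (1 / 50)) (h2 : BondIsoPinningP 1 2 (1 / 16) (1 / 50)) (h4 : BondIsoTearFreeP 1)
    (hl : BondIsoLevelsP 1 2 (1 / 16) (1 / 50))
    (hF : TailForceSlavingP 1 2 (1 / 16) (1 / 50))
    (hE' : LipDualLinearisationP 1 2 (1 / 16) (1 / 50)) (hA : L2HarmonicApproxP 1 2 (1 / 16) (1 / 50))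
    (hD : PositionDecayPL 1 2 (1 / 16) (1 / 50)) (hC : PositionCaccioppoliPG 1 2 (1 / 16) (1 / 50))
    (hw : WildReRegistrationPG 1 2 (1 / 16) (1 / 50)) (hG : PeriodicBulkGapDoor 2) : VisibleGap (1 / 50) ∧ PertRegime (1 / 50) :=
  gap_and_pert_1_50_of_certs_16XH10 hL hL' hR hX hE hP hT hU h1 h2 h4 hl hF hE' hA hD hC (wildFractionPG_of_wildReRegistrationPG hw) hG

end Summit.AtomisticToContinuum.Crystallization.Theorems.ChartedZeroExcessLayeredLatticeLiouville

end
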